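import Summits.HubbardSuperconductivity.HubbardSuperconductivity.Theorems.ColourTheSpinSgEndpointSpinDescent
import Literature.MathematicalPhysics.QuantumLattice.SpinGaugeTransformations
import Literature.MathematicalPhysics.QuantumLattice.PairChirality
import Summits.HubbardSuperconductivity.HubbardSuperconductivity.Theorems.DeformationLadderLowEnergyRigiditySpinSqueeze
import HarnessLib

/-!
# Crux `SgEndpoint` (stmt-HubbardSuperconductivity-16272, route `ColourTheSpin`), line `birth`:
# stub S3 `stub_pureGaugeDictionary` — the pure-gauge dictionary with spin lowering

Support file 2/2 (file 1: `ColourTheSpinSgEndpointSpinDescent`). The registered stub S3 of the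
birth skeleton `Cruxes/SgEndpoint/Lines/birth.lean` (`Sig.stub_pureGaugeDictionary`, with the
skeleton's local vocabulary `IsPureGauge`, `frozenHamiltonian`, `frozenPairField`,
`frozenGroundEnergy`, `IsFrozenGroundState` unfolded to the landed Literature objects, so that the
statement elaborates over the tree alone; the unfolded statement is definitionally the skeleton's):

for `L ≥ 3`, `U`, `a`, an even particle number `N`, a PURE-GAUGE link configuration
`k(x,i) = h_x h_{x+eᵢ}⁻¹` of the `Q₈`-spin-gauged Hubbard torus and an `N`-block ground state `φ` of
the frozen-link fermion Hamiltonian `H_F(k)` (the `(·,k)(·,k)` block of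
`spinGaugedHubbardTorusWith Q8.rep L U 0 0`) whose frozen transported pair order is
`a ‖φ‖² ≤ Re ⟨φ, P_k† P_k φ⟩` (`P_k` the `(·,k)(·,k)` block of `spinGaugedPairField L`), there is a
normalised `(N, S^z = 0)`-SECTOR ground state `ψ` of the summit's `hubbardTorus 2 L 1 U` with
`a ≤ Re ⟨ψ, Δ† Δ ψ⟩`, `Δ = pairField dWaveFormFactor L`.

## Proof

* **Gauge covariance, block form** (`block_mul_of_kronecker_perm_commute`): if `W = F ⊗ P_e`
  (`P_e |k⟩ = |e k⟩`, `e` injective) commutes with `X`, then `F · X[k₀] = X[e k₀] · F` for the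
  diagonal link blocks `X[k] = X(·,k)(·,k)`. With `W = gaugeTransform Q8.rep L h`
  (`commute_gaugeTransform_spinGaugedHubbardTorusWith`, `commute_gaugeTransform_spinGaugedPairField`)
  and `k = gaugeAct L h 1` this gives `Γ H_F(1) = H_F(k) Γ`, `Γ P_1 = P_k Γ`, `Γ = Γ(⊕ ρ(h_x))`
  unitary and particle-number preserving; and `H_F(1) = hubbardTorus 2 L 1 U` (`L ≥ 3`),
  `P_1 = Δ/√2` (`spinGaugedHubbardTorusWith_apply_one_one`, `spinGaugedPairField_apply_one_one`).
  Hence `φ' = Γᴴ φ` is a nonzero `N`-particle eigenvector of the torus at the frozen energy `e`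
  with `2a ‖φ'‖² ≤ Re ⟨φ', Δ†Δ φ'⟩`, and `e ≤` every `N`-particle Rayleigh quotient of the torus.
* **Spin descent** (`exists_isInSector_of_rayleigh`, file 1) inside the `e`-eigenspace to the
  coordinate sector `(N/2, N/2)`, keeping the ratio `2a` (`Δ†Δ` preserves sectors and commutes
  with `S^±`: `Δ` is a sum of singlet pairs of grade `(-1,-1)`).
* The sector energy equals `e` (the sector vector is an `N`-particle unit vector of energy `e`, and
  every sector Rayleigh quotient is `≥ e`), so the normalised vector is an `IsGroundStateInSector`
  ground state with `Re ⟨Δ†Δ⟩ ≥ max (2a, 0) ≥ a`.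

Sources: Lieb, PRL 62 (1989) 1201; Tasaki (2020) §2.2, §9.3; Kogut–Susskind, PRD 11 (1975) 395
and Bietenholz–Wiese (2025) §11.8 (gauge covariance); Fradkin–Shenker, PRD 19 (1979) 3682
(gauge-invariant composites); Scalapino, Phys. Rep. 250 (1995) 329, §2 (pair field). All folklore.
-/

noncomputable section

namespace Summit.HubbardSuperconductivity.ColourTheSpin.SgEndpoint

open Matrix Finset Literature.MathematicalPhysics.QuantumLattice Literature.Probability.LatticeModels
open scoped ComplexOrder Kronecker

/-! ### Gauge covariance in block form -/

section Block

variable {A K : Type*} [Fintype A] [Fintype K] [DecidableEq A] [DecidableEq K]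

omit [DecidableEq A] in
/-- **Transport of diagonal link blocks.** If `W = F ⊗ P_e` (`P_e` the permutation matrix
`|k⟩ ↦ |e k⟩` of an injective `e`) commutes with `X`, then `F · X[k₀] = X[e k₀] · F` for the
diagonal link blocks `X[k] = X(·,k)(·,k)` (evaluate `W X = X W` at `((s, e k₀), (s', k₀))`).
[folklore] -/
theorem block_mul_of_kronecker_perm_commute (F : Matrix A A ℂ) {e : K → K}
    (he : Function.Injective e) (X : Matrix (A × K) (A × K) ℂ)
    (h : (F ⊗ₖ (Matrix.of fun k k' : K => if k = e k' then (1 : ℂ) else 0)) * X =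
      X * (F ⊗ₖ (Matrix.of fun k k' : K => if k = e k' then (1 : ℂ) else 0))) (k₀ : K) :
    F * (Matrix.of fun s s' => X (s, k₀) (s', k₀)) =
      (Matrix.of fun s s' => X (s, e k₀) (s', e k₀)) * F := by
  ext s s'
  have h1 := congrFun (congrFun h (s, e k₀)) (s', k₀)
  simp only [Matrix.mul_apply, Fintype.sum_prod_type, Matrix.kroneckerMap_apply, Matrix.of_apply]
    at h1 ⊢
  have hl : ∀ c : A, ∑ j : K, F s c * (if e k₀ = e j then (1 : ℂ) else 0) * X (c, j) (s', k₀) =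
      F s c * X (c, k₀) (s', k₀) := by
    intro c
    rw [Finset.sum_eq_single k₀]
    · simp
    · intro j _ hj
      rw [if_neg (fun h' => hj (he h').symm), mul_zero, zero_mul]
    · intro h'
      exact absurd (Finset.mem_univ _) h'
  have hr : ∀ c : A, ∑ j : K, X (s, e k₀) (c, j) * (F c s' * if j = e k₀ then (1 : ℂ) else 0) =
      X (s, e k₀) (c, e k₀) * F c s' := by
    intro c
    rw [Finset.sum_eq_single (e k₀)]
    · simp
    · intro j _ hj
      rw [if_neg hj, mul_zero, mul_zero]
    · intro h'
      exact absurd (Finset.mem_univ _) h'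
  simp only [hl, hr] at h1
  exact h1

end Block

section Covariance

variable (L : ℕ) [NeZero L]

/-- **Gauge covariance of the frozen-link Hamiltonian blocks**: for every gauge function `η`
and all couplings, `Γ(η) · H[k₀] = H[η · k₀] · Γ(η)` for the diagonal link blocks of
`spinGaugedHubbardTorusWith Q8.rep L U gE gB` (`commute_gaugeTransform_spinGaugedHubbardTorusWith`
read blockwise). Kogut–Susskind (1975); Bietenholz–Wiese (2025) §11.8. [folklore] -/
theorem fermionGauge_mul_hamiltonianBlock (η : FermionTorus 2 L → Q8) (U gE gB : ℝ)
    (k₀ : GaugedHubbard.Bond L → Q8) :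
    SpinGauged.fermionGauge Q8.rep L η *
        (Matrix.of fun s s' => spinGaugedHubbardTorusWith Q8.rep L U gE gB (s, k₀) (s', k₀)) =
      (Matrix.of fun s s' => spinGaugedHubbardTorusWith Q8.rep L U gE gB
          (s, SpinGauged.gaugeAct L η k₀) (s', SpinGauged.gaugeAct L η k₀)) *
        SpinGauged.fermionGauge Q8.rep L η :=
  block_mul_of_kronecker_perm_commute _ (SpinGauged.gaugeActEquiv L η).injective _
    (SpinGauged.commute_gaugeTransform_spinGaugedHubbardTorusWith Q8.rep L
      Q8.rep_mem_unitaryGroup η U gE gB).eq k₀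

/-- **Gauge covariance of the transported pair-field blocks**: `Γ(η) · P[k₀] = P[η · k₀] · Γ(η)`
for the diagonal link blocks of `spinGaugedPairField L`
(`commute_gaugeTransform_spinGaugedPairField` read blockwise). Fradkin–Shenker (1979). [folklore] -/
theorem fermionGauge_mul_pairFieldBlock (η : FermionTorus 2 L → Q8) (k₀ : GaugedHubbard.Bond L → Q8) :
    SpinGauged.fermionGauge Q8.rep L η * (Matrix.of fun s s' => spinGaugedPairField L (s, k₀) (s', k₀)) =
      (Matrix.of fun s s' => spinGaugedPairField L
          (s, SpinGauged.gaugeAct L η k₀) (s', SpinGauged.gaugeAct L η k₀)) *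
        SpinGauged.fermionGauge Q8.rep L η :=
  block_mul_of_kronecker_perm_commute _ (SpinGauged.gaugeActEquiv L η).injective _
    (SpinGauged.commute_gaugeTransform_spinGaugedPairField L η).eq k₀

/-- A pure-gauge configuration is the gauge transform of the trivial one:
`η · 1 = (b ↦ η_x η_{x+eᵢ}⁻¹)`. [folklore] -/
theorem gaugeAct_one_eq (η : FermionTorus 2 L → Q8) :
    SpinGauged.gaugeAct L η 1 = fun b => η b.1 * (η (b.1.shift b.2))⁻¹ := by
  funext b
  simp

/-- The frozen-link Hamiltonian block at the trivial configuration (no electric, no magnetic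
term) IS the summit's `hubbardTorus 2 L 1 U` for `L ≥ 3`
(`spinGaugedHubbardTorusWith_apply_one_one`). [folklore] -/
theorem hamiltonianBlock_one (hL : 3 ≤ L) (U : ℝ) :
    (Matrix.of fun s s' => spinGaugedHubbardTorusWith Q8.rep L U 0 0
        (s, (1 : GaugedHubbard.Bond L → Q8)) (s', 1)) = hubbardTorus 2 L 1 U := by
  ext s s'
  rw [Matrix.of_apply, spinGaugedHubbardTorusWith_apply_one_one Q8.rep L hL]
  simp

/-- The transported pair-field block at the trivial configuration is `Δ/√2`
(`spinGaugedPairField_apply_one_one`). Scalapino (1995) §2. [folklore] -/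
theorem pairFieldBlock_one :
    (Matrix.of fun s s' => spinGaugedPairField L (s, (1 : GaugedHubbard.Bond L → Q8)) (s', 1)) =
      (((Real.sqrt 2)⁻¹ : ℝ) : ℂ) • pairField dWaveFormFactor L := by
  ext s s'
  rw [Matrix.of_apply, spinGaugedPairField_apply_one_one, Matrix.smul_apply, smul_eq_mul]

/-- The pair order `Δ_gᴴ Δ_g` commutes with `S⁺` (from the landed `[S^±, Δ_g] = 0`,
`DeformationLadder.ss_spinPlus/Minus_commute_pairField`). [folklore] -/
theorem pairOrder_commute_spinPlus (g : Site 2 → ℝ) :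
    Commute ((pairField g L)ᴴ * pairField g L) (spinPlus : Matrix (Finset (Orb (FermionTorus 2 L))) _ ℂ) := by
  have h1 : Commute (pairField g L) spinPlus :=
    (Summit.HubbardSuperconductivity.HubbardSuperconductivity.Theorems.DeformationLadder.ss_spinPlus_commute_pairField
      L g).symm
  have h2 : Commute (pairField g L)ᴴ (spinPlus : Matrix (Finset (Orb (FermionTorus 2 L))) _ ℂ) := by
    have h := congrArg conjTranspose
      (Summit.HubbardSuperconductivity.HubbardSuperconductivity.Theorems.DeformationLadder.ss_spinMinus_commute_pairField
        L g).eq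
    rw [conjTranspose_mul, conjTranspose_mul, spinMinus, conjTranspose_conjTranspose] at h
    exact h
  exact h2.mul_left h1

/-- The pair order `Δ_gᴴ Δ_g` commutes with `S⁻` (the landed
`DeformationLadder.ss_spinMinus_commute_pairField_conjTranspose_mul`, as a `Commute` of the pair
order). [folklore] -/
theorem pairOrder_commute_spinMinus (g : Site 2 → ℝ) :
    Commute ((pairField g L)ᴴ * pairField g L) (spinMinus : Matrix (Finset (Orb (FermionTorus 2 L))) _ ℂ) :=
  (Summit.HubbardSuperconductivity.HubbardSuperconductivity.Theorems.DeformationLadder.ss_spinMinus_commute_pairField_conjTranspose_mul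
    L g).symm

/-- The pair order `Δ_gᴴ Δ_g` preserves the coordinate sectors `(N↑, N↓)` (`Δ_g` has grade
`(-1,-1)`). [folklore] -/
theorem preservesSectors_pairOrder (g : Site 2 → ℝ) :
    PreservesSectors ((pairField g L)ᴴ * pairField g L) := by
  have hS : PairChirality.Shifts (-1) (-1) (pairField g L) := by
    unfold pairField
    exact PairChirality.Shifts.sum fun x _ => PairChirality.shifts_localPair L g x
  have hP := hS.conjTranspose.mul hS
  norm_num at hP
  exact hP.preservesSectors

end Covariance

/-! ### The stub -/

section Stub

/-- **Stub S3 `stub_pureGaugeDictionary` of the birth line of crux `SgEndpoint`** (the skeleton's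
`Sig.stub_pureGaugeDictionary` with its local vocabulary `IsPureGauge`, `IsFrozenGroundState`,
`frozenHamiltonian`, `frozenGroundEnergy`, `frozenPairField` unfolded): for `L ≥ 3`, `U`, `a`, an even
`N`, a pure-gauge `Q₈` link configuration `k = (b ↦ h_x h_{x+eᵢ}⁻¹)` and an `N`-block ground state
`φ` of the frozen-link block `H_F(k) = (spinGaugedHubbardTorusWith Q8.rep L U 0 0)(·,k)(·,k)` with
frozen transported pair order `a ‖φ‖² ≤ Re ⟨φ, P_k† P_k φ⟩`
(`P_k = (spinGaugedPairField L)(·,k)(·,k)`), there is a normalised `(N, S^z = 0)`-sector ground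
state `ψ` of `hubbardTorus 2 L 1 U` with `a ≤ Re ⟨ψ, Δ†Δ ψ⟩`, `Δ = pairField dWaveFormFactor L`.
Gauge covariance transports `φ` to the trivial configuration (`H_F(1) = hubbardTorus`,
`P_1 = Δ/√2`, ratio `2a`), the spin descent `exists_isInSector_of_rayleigh` moves it to the
coordinate sector `(N/2, N/2)` inside the same eigenspace without lowering the pair ratio, and
the sector energy equals the `N`-block energy there. Lieb, PRL 62 (1989) 1201; Tasaki (2020)
§2.2, §9.3; Kogut–Susskind (1975); Scalapino (1995) §2. [folklore] -/
theorem stub_pureGaugeDictionary :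
    ∀ (L : ℕ) [NeZero L], 3 ≤ L → ∀ (U a : ℝ) (N : ℕ), Even N →
      ∀ k : GaugedHubbard.Bond L → Q8,
        (∃ h : FermionTorus 2 L → Q8, ∀ b : GaugedHubbard.Bond L, k b = h b.1 * (h (b.1.shift b.2))⁻¹) →
        ∀ φ : Fock (Orb (FermionTorus 2 L)),
          (φ ∈ (nParticleSubmodule N : Submodule ℂ (Fock (Orb (FermionTorus 2 L)))) ∧ φ ≠ 0 ∧
            (Matrix.of fun s s' => spinGaugedHubbardTorusWith Q8.rep L U 0 0 (s, k) (s', k)) *ᵥ φ =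
              (((Matrix.of fun s s' =>
                  spinGaugedHubbardTorusWith Q8.rep L U 0 0 (s, k) (s', k)).minEnergyOn
                (nParticleSubmodule N : Submodule ℂ (Fock (Orb (FermionTorus 2 L)))) : ℝ) : ℂ) • φ) →
          a * (star φ ⬝ᵥ φ).re ≤
            (star φ ⬝ᵥ ((Matrix.of fun s s' => spinGaugedPairField L (s, k) (s', k))ᴴ *
              (Matrix.of fun s s' => spinGaugedPairField L (s, k) (s', k))) *ᵥ φ).re →
          ∃ ψ : Fock (Orb (FermionTorus 2 L)), star ψ ⬝ᵥ ψ = 1 ∧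
            IsGroundStateInSector (hubbardTorus 2 L 1 U) N 0 ψ ∧
              a ≤ (expect ((pairField dWaveFormFactor L)ᴴ * pairField dWaveFormFactor L) ψ).re := by
  intro L _ hL U a N hN k hk φ hφ hord
  classical
  obtain ⟨h, hh⟩ := hk
  have hk1 : k = SpinGauged.gaugeAct L h 1 := by
    rw [gaugeAct_one_eq]; funext b; exact hh b
  subst hk1
  obtain ⟨n, hn⟩ := hN
  rw [← two_mul] at hn
  subst hn
  -- notation
  set F := SpinGauged.fermionGauge Q8.rep L h with hF
  set Hk := (Matrix.of fun s s' => spinGaugedHubbardTorusWith Q8.rep L U 0 0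
    (s, SpinGauged.gaugeAct L h 1) (s', SpinGauged.gaugeAct L h 1)) with hHk
  set Pk := (Matrix.of fun s s' => spinGaugedPairField L
    (s, SpinGauged.gaugeAct L h 1) (s', SpinGauged.gaugeAct L h 1)) with hPk
  set H₁ := hubbardTorus 2 L 1 U with hH₁
  set Δ := pairField dWaveFormFactor L with hΔ
  set c : ℝ := (Real.sqrt 2)⁻¹ with hc
  set e : ℝ := Hk.minEnergyOn (nParticleSubmodule (2 * n) : Submodule ℂ (Fock (Orb (FermionTorus 2 L))))
    with he
  obtain ⟨hφN, hφ0, hφE⟩ := hφ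
  -- unitarity and covariance
  have hFF : Fᴴ * F = 1 :=
    SpinGauged.fermionGauge_conjTranspose_mul_self Q8.rep L Q8.rep_mem_unitaryGroup h
  have hFF' : F * Fᴴ = 1 :=
    SpinGauged.fermionGauge_mul_conjTranspose Q8.rep L Q8.rep_mem_unitaryGroup h
  have hcovH : F * H₁ = Hk * F := by
    rw [hH₁, ← hamiltonianBlock_one L hL U]
    exact fermionGauge_mul_hamiltonianBlock L h U 0 0 1
  have hcovP : F * ((c : ℂ) • Δ) = Pk * F := by
    rw [hΔ, hc, ← pairFieldBlock_one L]
    exact fermionGauge_mul_pairFieldBlock L h 1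
  have hH₁eq : H₁ = Fᴴ * Hk * F := by
    rw [Matrix.mul_assoc, ← hcovH, ← Matrix.mul_assoc, hFF, Matrix.one_mul]
  have hHkeq : Hk = F * H₁ * Fᴴ := by
    rw [Matrix.mul_assoc, hH₁eq, Matrix.mul_assoc, Matrix.mul_assoc, hFF', Matrix.mul_one,
      ← Matrix.mul_assoc, hFF', Matrix.one_mul]
  have hH₁herm : H₁.IsHermitian := LiebThm1.hamiltonian_isHermitian (fermionTorusGraph 2 L) 1 U
  have hHkherm : Hk.IsHermitian := by
    rw [hHkeq]
    exact Matrix.isHermitian_mul_mul_conjTranspose F hH₁herm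
  -- the transported vector `φ' = Fᴴ φ`
  set φ' := Fᴴ *ᵥ φ with hφ'
  have hFφ' : F *ᵥ φ' = φ := by rw [hφ', mulVec_mulVec, hFF', one_mulVec]
  have hφ'N : IsNParticle (2 * n) φ' := by
    have hFt : Fᴴ = Gamma (SpinGauged.spinRotation fun x => Q8.rep (h x))ᴴ := by
      rw [hF, SpinGauged.fermionGauge, Gamma_conjTranspose]
    rw [hφ', hFt]
    exact isNParticle_Gamma_mulVec _ ((mem_nParticleSubmodule_iff _ φ).1 hφN)
  have hφ'0 : φ' ≠ 0 := fun h0 => hφ0 (by rw [← hFφ', h0, mulVec_zero])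
  have hH₁φ' : H₁ *ᵥ φ' = (e : ℂ) • φ' := by
    rw [hH₁eq, Matrix.mul_assoc, ← mulVec_mulVec, ← mulVec_mulVec, hFφ', hφE, mulVec_smul]
  -- the pair order transported: `2a ‖φ'‖² ≤ Re ⟨φ', Δ†Δ φ'⟩`
  have hnorm : star φ ⬝ᵥ φ = star φ' ⬝ᵥ φ' := by
    rw [← hFφ', star_mulVec_dotProduct_mulVec_of_unitary hFF]
  have hcc : c * c = 1 / 2 := by
    rw [hc, ← mul_inv, Real.mul_self_sqrt (by norm_num : (0 : ℝ) ≤ 2), one_div]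
  have hpair : star φ ⬝ᵥ (Pkᴴ * Pk) *ᵥ φ = (((1 / 2 : ℝ)) : ℂ) * (star φ' ⬝ᵥ (Δᴴ * Δ) *ᵥ φ') := by
    rw [LiebThm1.star_dotProduct_conjTranspose_mul_mulVec, ← hFφ', mulVec_mulVec, ← hcovP,
      ← mulVec_mulVec, star_mulVec_dotProduct_mulVec_of_unitary hFF, smul_mulVec,
      EigenvalueContinuation.star_real_smul_dotProduct_real_smul, hcc,
      LiebThm1.star_dotProduct_conjTranspose_mul_mulVec]
  have hord' : 2 * a * (star φ' ⬝ᵥ φ').re ≤ (star φ' ⬝ᵥ (Δᴴ * Δ) *ᵥ φ').re := by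
    rw [hnorm, hpair, Complex.re_ofReal_mul] at hord
    linarith
  -- spin descent to the sector `(n, n)`
  obtain ⟨u, hu, hu0, hHu, hru⟩ := exists_isInSector_of_rayleigh H₁ (Δᴴ * Δ)
    (Matrix.isHermitian_conjTranspose_mul_self Δ)
    (LiebThm1.preservesSectors_hamiltonian (fermionTorusGraph 2 L) 1 U)
    (preservesSectors_pairOrder L dWaveFormFactor)
    (LiebThm1.hamiltonian_commute_spinPlus (fermionTorusGraph 2 L) 1 U)
    (LiebThm1.hamiltonian_commute_spinMinus (fermionTorusGraph 2 L) 1 U)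
    (pairOrder_commute_spinPlus L dWaveFormFactor) (pairOrder_commute_spinMinus L dWaveFormFactor)
    n e (2 * a) hφ'N hφ'0 hH₁φ' hord'
  -- normalise
  obtain ⟨c₁, hc₁, hcc₁, hc₁1⟩ := EigenvalueContinuation.exists_normalize hu0
  set ψ := (c₁ : ℂ) • u with hψ
  have hψsec : IsInSector n n ψ := fun s hs => by
    rw [hψ, Pi.smul_apply, hu s hs, smul_zero]
  have hψmem : ψ ∈ szSector (Λ := FermionTorus 2 L) (2 * n) 0 :=
    (mem_szSector_two_mul_zero_iff n ψ).2 hψsec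
  have hψ0 : ψ ≠ 0 := smul_ne_zero (by exact_mod_cast hc₁.ne') hu0
  have hHψ : H₁ *ᵥ ψ = (e : ℂ) • ψ := by rw [hψ, mulVec_smul, hHu, smul_comm]
  -- the sector energy is `e`
  set e₀ : ℝ := H₁.minEnergyOn (szSector (Λ := FermionTorus 2 L) (2 * n) 0) with he₀
  have hle₀ : e₀ ≤ e := by
    have h1 := minEnergyOn_le_rayleigh_of_mem hH₁herm _ hψmem hc₁1
    rwa [EigenvalueContinuation.re_star_dotProduct_mulVec_of_eigen hHψ, hc₁1, Complex.one_re,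
      mul_one] at h1
  have hge₀ : e ≤ e₀ := by
    refine le_csInf ⟨_, ψ, hψmem, hc₁1, rfl⟩ ?_
    rintro E ⟨χ, hχ, hχ1, rfl⟩
    have hχN : IsNParticle (2 * n) χ := ((mem_szSector_iff _ _ χ).1 hχ).1
    have hFχN : F *ᵥ χ ∈ (nParticleSubmodule (2 * n) : Submodule ℂ (Fock (Orb (FermionTorus 2 L)))) := by
      rw [mem_nParticleSubmodule_iff, hF, SpinGauged.fermionGauge]
      exact isNParticle_Gamma_mulVec _ hχN
    have hFχ1 : star (F *ᵥ χ) ⬝ᵥ (F *ᵥ χ) = 1 := by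
      rw [star_mulVec_dotProduct_mulVec_of_unitary hFF, hχ1]
    have h2 := minEnergyOn_le_rayleigh_of_mem hHkherm _ hFχN hFχ1
    rwa [← star_dotProduct_conj_mulVec, ← hH₁eq] at h2
  have hee : e = e₀ := le_antisymm hge₀ hle₀
  refine ⟨ψ, hc₁1, ⟨hψmem, hψ0, by rw [hHψ, ← he₀, ← hee]⟩, ?_⟩
  -- the pair ratio
  have hval : 2 * a ≤ (expect (Δᴴ * Δ) ψ).re := by
    have h1 : (expect (Δᴴ * Δ) ψ).re = c₁ * c₁ * (star u ⬝ᵥ (Δᴴ * Δ) *ᵥ u).re := by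
      rw [Literature.MathematicalPhysics.QuantumLattice.expect, hψ, mulVec_smul, EigenvalueContinuation.star_real_smul_dotProduct_real_smul,
        Complex.re_ofReal_mul]
    rw [h1]
    have hpos : 0 ≤ c₁ * c₁ := mul_self_nonneg c₁
    calc 2 * a = 2 * a * (c₁ * c₁ * (star u ⬝ᵥ u).re) := by rw [hcc₁, mul_one]
      _ = c₁ * c₁ * (2 * a * (star u ⬝ᵥ u).re) := by ring
      _ ≤ c₁ * c₁ * (star u ⬝ᵥ (Δᴴ * Δ) *ᵥ u).re := mul_le_mul_of_nonneg_left hru hpos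
  have hnn : 0 ≤ (expect (Δᴴ * Δ) ψ).re := by
    rw [Literature.MathematicalPhysics.QuantumLattice.expect, LiebThm1.star_dotProduct_conjTranspose_mul_mulVec]
    exact EigenvalueContinuation.re_star_dotProduct_self_nonneg _
  rcases le_or_gt a 0 with ha | ha
  · exact ha.trans hnn
  · linarith

end Stub

end Summit.HubbardSuperconductivity.ColourTheSpin.SgEndpoint

end
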